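import Summits.QuantumFields.YangMills.Theorems.ComplexCouplingChannelHarmonicMeasureEngineDiscChain
import Summits.QuantumFields.YangMills.Theorems.ComplexCouplingChannelHarmonicMeasureEngineTorusLegPrelims

/-!
# The torus leg of `HarmonicMeasureEngine`: exponentially small finite-size free energy at `β`

Helper file for item `stmt-QuantumFields-18844` (`HarmonicMeasureEngine`, route `ComplexCouplingChannel` of
`QuantumFields/YangMills`), abstract-analytic part of the "new thermal leg".  For a family of functions
`Z P : ℂ → ℂ` (the symmetric-torus partition functions `Z(z; P, P)`) we assume exactly the shapes of the
route's hypotheses: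

* (anchor, torus clause of `ComplexStrongCouplingAnchor`) on the strong-coupling disc `‖z‖ < ρ₀`: `Z P` is
  holomorphic and zero-free, `Z P 0 = 1`, and `|log ‖Z P z‖ + P⁴ Re f_A z| ≤ C P⁴ e^{-cP}` for one analytic `f_A`;
* (window, `FreeEnergyWindowChannel`) on an open connected channel `D ∋ β` containing a point `x` of the
  disc: `Z P` holomorphic and zero-free and `|log ‖Z P z‖ + P⁴ Re f z| ≤ M` for `P ≥ P₀`, one analytic `f`.

Conclusion (`abs_log_norm_add_le_exp_neg_of_window`): `|log ‖Z P β‖ + P⁴ Re f β| ≤ C' e^{-aP}` for all large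
`P`, some `a > 0` — the finite-size free energy of the symmetric torus at the real coupling `β` is
exponentially small, the input of the thermal-trace bound `θ_P ≤ e^{ε_P} − 1` of the engine.

Proof: holomorphic logarithm `g_P` of `Z P` on the disc with `g_P 0 = 0`;
`φ_P = g_P + P⁴ f_A − i P⁴ Im f_A 0` has `Re φ_P ≤ η_P = max C 1 · P⁴ e^{-cP}` and `φ_P 0 ∈ ℝ` small, so
Borel–Carathéodory bounds `‖φ_P‖ ≤ A η_P` on a smaller disc containing `x`; on a ball around `x` the two
bounds force `Re f = Re f_A`, hence `f − f_A ≡ w ∈ iℝ` (open mapping); the holomorphic function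
`h_P = Z P · e^{P⁴ (f − w) − i P⁴ Im f_A 0} − 1` is bounded by `e^M + 1` on `D` and by `2Aη_P` near `x`, so the
disc-chain two-constants estimate (`exists_exponent_norm_le_rpow_mul_rpow`) gives `‖h_P β‖ ≤ C₁ e^{-aP}`,
`a = cθ/2`, and `log ‖1 + h_P β‖ = log ‖Z P β‖ + P⁴ Re f β`.

References: the route file `Summits/QuantumFields/YangMills/Theses/ComplexCouplingChannel.lean` (engine,
thermal leg); preliminaries in `ComplexCouplingChannelHarmonicMeasureEngineTorusLegPrelims.lean`.
-/

open Complex Metric Set Filter Topology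

namespace Summit.QuantumFields.YangMills.Theorems.ComplexCouplingChannel

/-- **The torus leg of the engine (abstract form).**  Let `Z P : ℂ → ℂ` (`P : ℕ`) be holomorphic and
zero-free on the disc `ball 0 ρ₀` with `Z P 0 = 1` and the ANCHOR bound
`|log ‖Z P z‖ + P⁴ Re f_A z| ≤ C P⁴ e^{−cP}` (`P ≥ 1`, one analytic `f_A`), and holomorphic and zero-free on an
open preconnected channel `D` containing `β` and a point `x` of the disc, with the WINDOW bound
`|log ‖Z P z‖ + P⁴ Re f z| ≤ M` (`P ≥ P₀`, one analytic `f` on `D`).  Then the finite-size free energy at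
`β` is exponentially small: `|log ‖Z P β‖ + P⁴ Re f β| ≤ C' e^{−aP}` for all `P ≥ P₁`, some `a > 0`.
This is the hypothesis shape of the route's `ComplexStrongCouplingAnchor` (torus clause) and
`FreeEnergyWindowChannel`, and the conclusion feeds the thermal-trace bound of `HarmonicMeasureEngine`.
Proof: holomorphic logarithm + Borel–Carathéodory on the disc, `Re f = Re f_A` near `x` (so `f − f_A ≡ iκ`
by the open mapping theorem), and the disc-chain two-constants estimate
`exists_exponent_norm_le_rpow_mul_rpow` applied to `h_P = Z P · e^{P⁴ (f − iκ) − i P⁴ Im f_A 0} − 1`,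
bounded by `e^M + 1` on `D` and by `2Aη_P`, `η_P = max C 1 · P⁴ e^{−cP}`, near `x`. [folklore] -/
theorem abs_log_norm_add_le_exp_neg_of_window
    (Z : ℕ → ℂ → ℂ) {ρ₀ c C : ℝ} (hρ₀ : 0 < ρ₀) (hc : 0 < c)
    (hZb : ∀ P, DifferentiableOn ℂ (Z P) (ball 0 ρ₀)) (hZ1 : ∀ P, Z P 0 = 1)
    {fA : ℂ → ℂ} (hfA : DifferentiableOn ℂ fA (ball 0 ρ₀))
    (hA : ∀ P : ℕ, 1 ≤ P → ∀ z : ℂ, ‖z‖ < ρ₀ → Z P z ≠ 0 ∧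
      |Real.log ‖Z P z‖ + (P : ℝ) ^ 4 * (fA z).re| ≤ C * (P : ℝ) ^ 4 * Real.exp (-(c * P)))
    {D : Set ℂ} (hD : IsOpen D) (hDc : IsPreconnected D) (hZD : ∀ P, DifferentiableOn ℂ (Z P) D)
    {β : ℂ} (hβ : β ∈ D) {x : ℂ} (hx : ‖x‖ < ρ₀) (hxD : x ∈ D)
    {f : ℂ → ℂ} (hf : DifferentiableOn ℂ f D) {M : ℝ} {P₀ : ℕ}
    (hW : ∀ P : ℕ, P₀ ≤ P → ∀ z ∈ D, Z P z ≠ 0 ∧ |Real.log ‖Z P z‖ + (P : ℝ) ^ 4 * (f z).re| ≤ M) :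
    ∃ a : ℝ, 0 < a ∧ ∃ C' : ℝ, ∃ P₁ : ℕ, ∀ P : ℕ, P₁ ≤ P →
      |Real.log ‖Z P β‖ + (P : ℝ) ^ 4 * (f β).re| ≤ C' * Real.exp (-(a * P)) := by
  /- constants -/
  set Cp : ℝ := max C 1 with hCp
  have hCp1 : 1 ≤ Cp := le_max_right _ _
  have hCp0 : 0 < Cp := lt_of_lt_of_le one_pos hCp1
  have hM0 : 0 ≤ M := (abs_nonneg _).trans (hW P₀ le_rfl β hβ).2
  set η : ℕ → ℝ := fun P => Cp * (P : ℝ) ^ 4 * Real.exp (-(c * P)) with hη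
  have hη0 : ∀ P : ℕ, 1 ≤ P → 0 < η P := fun P hP => by
    have : (0 : ℝ) < P := by exact_mod_cast hP
    rw [hη]; positivity
  have hAη : ∀ P : ℕ, 1 ≤ P → ∀ z : ℂ, ‖z‖ < ρ₀ →
      |Real.log ‖Z P z‖ + (P : ℝ) ^ 4 * (fA z).re| ≤ η P := fun P hP z hz => by
    refine (hA P hP z hz).2.trans ?_
    rw [hη]
    exact mul_le_mul_of_nonneg_right (mul_le_mul_of_nonneg_right (le_max_left _ _) (by positivity))
      (Real.exp_pos _).le
  /- radii -/
  set r₁ : ℝ := (‖x‖ + ρ₀) / 2 with hr₁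
  have hxr₁ : ‖x‖ < r₁ := by rw [hr₁]; linarith
  have hr₁ρ : r₁ < ρ₀ := by rw [hr₁]; linarith
  have hr₁0 : 0 < r₁ := lt_of_le_of_lt (norm_nonneg x) hxr₁
  set A : ℝ := (ρ₀ + 3 * r₁) / (ρ₀ - r₁) with hAdef
  have hA0 : 0 < A := by rw [hAdef]; exact div_pos (by linarith) (by linarith)
  obtain ⟨r, hr0, hrsub⟩ : ∃ r > 0, ball x r ⊆ D ∩ ball 0 r₁ :=
    Metric.isOpen_iff.1 (hD.inter isOpen_ball) x ⟨hxD, by rwa [mem_ball_zero_iff]⟩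
  have hrD : ball x r ⊆ D := fun z hz => (hrsub hz).1
  have hrρ : ball x r ⊆ ball 0 ρ₀ := fun z hz =>
    mem_ball_zero_iff.2 ((mem_ball_zero_iff.1 (hrsub hz).2).trans hr₁ρ)
  /- the exponent of the disc chain -/
  obtain ⟨θ, hθ0, hθ1, hchain⟩ := exists_exponent_norm_le_rpow_mul_rpow hD hDc hxD hβ hr0
  /- Step 1: normalised logarithms on the disc and Borel–Carathéodory -/
  have hφ : ∀ P : ℕ, 1 ≤ P → ∃ g : ℂ → ℂ, (∀ z ∈ ball 0 ρ₀, exp (g z) = Z P z) ∧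
      ∀ z : ℂ, ‖z‖ ≤ r₁ →
        ‖g z + (P : ℂ) ^ 4 * fA z - (((P : ℝ) ^ 4 * (fA 0).im : ℝ) : ℂ) * I‖ ≤ A * η P := by
    intro P hP
    obtain ⟨g, hgd, hg0, hge⟩ := exists_differentiableOn_exp_eq hρ₀ (hZb P)
      (fun z hz => (hA P hP z (mem_ball_zero_iff.1 hz)).1) (hZ1 P)
    refine ⟨g, hge, ?_⟩
    set φ : ℂ → ℂ := fun z => g z + (P : ℂ) ^ 4 * fA z - (((P : ℝ) ^ 4 * (fA 0).im : ℝ) : ℂ) * I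
      with hφdef
    have hφd : DifferentiableOn ℂ φ (ball 0 ρ₀) :=
      (hgd.add ((differentiableOn_const _).mul hfA)).sub (differentiableOn_const _)
    have hφre : ∀ z ∈ ball 0 ρ₀, (φ z).re = Real.log ‖Z P z‖ + (P : ℝ) ^ 4 * (fA z).re := by
      intro z hz
      have h1 : Real.log ‖Z P z‖ = (g z).re := by rw [← hge z hz, norm_exp, Real.log_exp]
      have h2 : ((P : ℂ) ^ 4 * fA z).re = (P : ℝ) ^ 4 * (fA z).re := by
        rw [show ((P : ℂ) ^ 4) = (((P : ℝ) ^ 4 : ℝ) : ℂ) from by push_cast; ring, re_ofReal_mul]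
      simp only [hφdef, sub_re, add_re, h1, h2, mul_re, ofReal_re, I_re, mul_zero, ofReal_im, I_im,
        mul_one, sub_self, sub_zero]
    have hre : ∀ z ∈ ball 0 ρ₀, (φ z).re ≤ η P := fun z hz => by
      rw [hφre z hz]; exact (abs_le.1 (hAη P hP z (mem_ball_zero_iff.1 hz))).2
    have hφ0 : ‖φ 0‖ ≤ η P := by
      have h0 : φ 0 = (((P : ℝ) ^ 4 * (fA 0).re : ℝ) : ℂ) := by
        apply Complex.ext
        · rw [hφre 0 (mem_ball_self hρ₀), hZ1 P, norm_one, Real.log_one, zero_add, ofReal_re]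
        · have hP4 : ((P : ℂ) ^ 4) = (((P : ℝ) ^ 4 : ℝ) : ℂ) := by push_cast; ring
          simp only [hφdef, hg0, zero_add, hP4, sub_im, mul_im, ofReal_re, ofReal_im, I_re, I_im, mul_one,
            mul_zero, add_zero]
          ring
      rw [h0, norm_real, Real.norm_eq_abs]
      have := hAη P hP 0 (by simpa using hρ₀)
      rwa [hZ1 P, norm_one, Real.log_one, zero_add] at this
    intro z hz
    have := norm_le_of_re_le_of_norm_zero_le hr₁0.le hr₁ρ (hη0 P hP) hφd hre hφ0 hz
    rw [← hAdef] at this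
    linarith [this, mul_comm A (η P)]
  /- Step 2: `Re f = Re f_A` on `ball x r` -/
  have hre0 : ∀ z ∈ ball x r, (f z - fA z).re = 0 := by
    intro z hz
    have hzD : z ∈ D := hrD hz
    have hzρ : ‖z‖ < ρ₀ := mem_ball_zero_iff.1 (hrρ hz)
    by_contra hne
    have hd : 0 < |(f z - fA z).re| := abs_pos.2 hne
    set d : ℝ := |(f z - fA z).re| with hddef
    -- for all large `P`: `d * P ≤ M + Cp / c`
    have key : ∀ P : ℕ, max P₀ 1 ≤ P → d * P ≤ M + Cp / c := by
      intro P hP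
      have hP0 : P₀ ≤ P := le_trans (le_max_left _ _) hP
      have hP1 : 1 ≤ P := le_trans (le_max_right _ _) hP
      have hPr : (1 : ℝ) ≤ P := by exact_mod_cast hP1
      have h1 := (hW P hP0 z hzD).2
      have h2 := hAη P hP1 z hzρ
      have h3 : (P : ℝ) ^ 4 * d ≤ M + η P := by
        rw [hddef, sub_re, ← abs_of_pos (by positivity : (0 : ℝ) < (P : ℝ) ^ 4), ← abs_mul, mul_sub]
        calc |(P : ℝ) ^ 4 * (f z).re - (P : ℝ) ^ 4 * (fA z).re|
            = |(Real.log ‖Z P z‖ + (P : ℝ) ^ 4 * (f z).re) - (Real.log ‖Z P z‖ + (P : ℝ) ^ 4 * (fA z).re)| := by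
              ring_nf
          _ ≤ |Real.log ‖Z P z‖ + (P : ℝ) ^ 4 * (f z).re| + |Real.log ‖Z P z‖ + (P : ℝ) ^ 4 * (fA z).re| :=
              abs_sub _ _
          _ ≤ M + η P := add_le_add h1 h2
      -- `η P ≤ (Cp / c) P³`
      have h4 : Real.exp (-(c * P)) * (c * P) ≤ 1 := by
        have := Real.add_one_le_exp (c * P)
        rw [Real.exp_neg, inv_mul_le_iff₀ (Real.exp_pos _)]
        linarith
      have h5 : η P ≤ Cp / c * (P : ℝ) ^ 3 := by
        show Cp * (P : ℝ) ^ 4 * Real.exp (-(c * P)) ≤ Cp / c * (P : ℝ) ^ 3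
        have : Cp * (P : ℝ) ^ 4 * Real.exp (-(c * P)) = Cp / c * (P : ℝ) ^ 3 * (Real.exp (-(c * P)) * (c * P)) := by
          field_simp
        rw [this]
        exact mul_le_of_le_one_right (by positivity) h4
      -- divide by `P³`
      have hP3 : (0 : ℝ) < (P : ℝ) ^ 3 := by positivity
      have h6 : (P : ℝ) ^ 4 * d ≤ M * (P : ℝ) ^ 3 + Cp / c * (P : ℝ) ^ 3 := by
        have : M ≤ M * (P : ℝ) ^ 3 := le_mul_of_one_le_right hM0 (one_le_pow₀ hPr)
        linarith
      have h7 : (P : ℝ) ^ 4 * d = (d * P) * (P : ℝ) ^ 3 := by ring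
      rw [h7, ← add_mul] at h6
      exact le_of_mul_le_mul_right h6 hP3
    obtain ⟨n, hn⟩ := exists_nat_gt ((M + Cp / c) / d)
    have hn' := key (max n (max P₀ 1)) (le_max_right _ _)
    have hle : (n : ℝ) ≤ (max n (max P₀ 1) : ℕ) := by exact_mod_cast le_max_left _ _
    rw [div_lt_iff₀ hd] at hn
    nlinarith
  /- Step 3: `f − f_A ≡ w` on `ball x r`, `Re w = 0` -/
  obtain ⟨w, hwre, hw⟩ : ∃ w : ℂ, w.re = 0 ∧ ∀ z ∈ ball x r, f z - fA z = w :=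
    exists_eq_const_of_re_eq_zero hr0 ((hf.mono hrD).sub (hfA.mono hrρ)) hre0
  /- Step 4: the functions `h_P` -/
  set E : ℕ → ℂ → ℂ := fun P z => (P : ℂ) ^ 4 * (f z - w) - (((P : ℝ) ^ 4 * (fA 0).im : ℝ) : ℂ) * I
    with hEdef
  set h : ℕ → ℂ → ℂ := fun P z => Z P z * exp (E P z) - 1 with hhdef
  have hEre : ∀ P z, (E P z).re = (P : ℝ) ^ 4 * (f z).re := by
    intro P z
    simp only [hEdef, sub_re, mul_re, ofReal_re, I_re, mul_zero, ofReal_im, I_im, mul_one, sub_self,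
      sub_zero, hwre]
    rw [show ((P : ℂ) ^ 4) = (((P : ℝ) ^ 4 : ℝ) : ℂ) from by push_cast; ring, ofReal_re, ofReal_im]
    ring
  have hhd : ∀ P, DifferentiableOn ℂ (h P) D := fun P =>
    ((hZD P).mul ((((differentiableOn_const _).mul (hf.sub (differentiableOn_const _))).sub
      (differentiableOn_const _)).cexp)).sub (differentiableOn_const _)
  set K : ℝ := Real.exp M + 1 with hKdef
  have hK0 : 0 < K := by rw [hKdef]; positivity
  -- the modulus of `Z e^{E}` is `exp (log ‖Z‖ + P⁴ Re f)`
  have hnormZE : ∀ P z, Z P z ≠ 0 →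
      ‖Z P z * exp (E P z)‖ = Real.exp (Real.log ‖Z P z‖ + (P : ℝ) ^ 4 * (f z).re) := by
    intro P z hz
    rw [norm_mul, norm_exp, hEre, Real.exp_add, Real.exp_log (norm_pos_iff.2 hz)]
  have hKbound : ∀ P : ℕ, P₀ ≤ P → ∀ z ∈ D, ‖h P z‖ ≤ K := by
    intro P hP z hz
    obtain ⟨hz0, hzM⟩ := hW P hP z hz
    calc ‖h P z‖ ≤ ‖Z P z * exp (E P z)‖ + ‖(1 : ℂ)‖ := norm_sub_le _ _
      _ ≤ Real.exp M + 1 := by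
          rw [hnormZE P z hz0, norm_one]
          exact add_le_add (Real.exp_le_exp.2 (abs_le.1 hzM).2) le_rfl
  -- near `x`, `h_P = e^{φ_P} − 1`
  have hsmall : ∀ P : ℕ, 1 ≤ P → A * η P ≤ 1 → ∀ z ∈ D, dist z x < r → ‖h P z‖ ≤ 2 * (A * η P) := by
    intro P hP hAη1 z _ hzx
    have hzb : z ∈ ball x r := hzx
    obtain ⟨g, hge, hgφ⟩ := hφ P hP
    have hz1 : ‖z‖ ≤ r₁ := (mem_ball_zero_iff.1 (hrsub hzb).2).le
    have hφz := hgφ z hz1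
    have hEq : Z P z * exp (E P z) =
        exp (g z + (P : ℂ) ^ 4 * fA z - (((P : ℝ) ^ 4 * (fA 0).im : ℝ) : ℂ) * I) := by
      rw [← hge z (hrρ hzb), ← exp_add]
      congr 1
      have hfz : f z - w = fA z := by rw [← hw z hzb]; ring
      simp only [hEdef, hfz]
      ring
    calc ‖h P z‖ = ‖exp (g z + (P : ℂ) ^ 4 * fA z - (((P : ℝ) ^ 4 * (fA 0).im : ℝ) : ℂ) * I) - 1‖ := by
          simp only [hhdef, hEq]
      _ ≤ 2 * ‖g z + (P : ℂ) ^ 4 * fA z - (((P : ℝ) ^ 4 * (fA 0).im : ℝ) : ℂ) * I‖ :=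
          norm_exp_sub_one_le (hφz.trans hAη1)
      _ ≤ 2 * (A * η P) := by linarith
  /- Step 5: rates -/
  set H₂ : ℝ := Cp * (24 / (c / 2) ^ 4) with hH₂
  have hH₂0 : 0 < H₂ := by rw [hH₂]; positivity
  have hηle : ∀ P : ℕ, η P ≤ H₂ * Real.exp (-(c / 2 * P)) := by
    intro P
    have h1 := pow_four_mul_exp_neg_le (half_pos hc) (Nat.cast_nonneg P)
    have h2 : Real.exp (-(c * P)) = Real.exp (-(c / 2 * P)) * Real.exp (-(c / 2 * P)) := by
      rw [← Real.exp_add]; congr 1; ring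
    show Cp * (P : ℝ) ^ 4 * Real.exp (-(c * P)) ≤ H₂ * Real.exp (-(c / 2 * P))
    rw [h2, hH₂]
    have h3 : Cp * (P : ℝ) ^ 4 * (Real.exp (-(c / 2 * P)) * Real.exp (-(c / 2 * P))) =
        Cp * ((P : ℝ) ^ 4 * Real.exp (-(c / 2 * P))) * Real.exp (-(c / 2 * P)) := by ring
    rw [h3]
    exact mul_le_mul_of_nonneg_right (mul_le_mul_of_nonneg_left h1 hCp0.le) (Real.exp_pos _).le
  set a : ℝ := c * θ / 2 with hadef
  have ha0 : 0 < a := by rw [hadef]; positivity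
  set C₁ : ℝ := (2 * A * H₂) ^ θ * K ^ (1 - θ) with hC₁
  have hC₁0 : 0 < C₁ := by rw [hC₁]; positivity
  /- Step 6: the threshold -/
  set P₁ : ℕ := max (max P₀ 1) (max ⌈(4 * (A * H₂)) / c⌉₊ ⌈(2 * C₁) / a⌉₊) with hP₁
  refine ⟨a, ha0, 2 * C₁, P₁, fun P hP => ?_⟩
  have hP0 : P₀ ≤ P := le_trans (le_trans (le_max_left _ _) (le_max_left _ _)) hP
  have hP1 : 1 ≤ P := le_trans (le_trans (le_max_right _ _) (le_max_left _ _)) hP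
  have hPa : ⌈(4 * (A * H₂)) / c⌉₊ ≤ P := le_trans (le_trans (le_max_left _ _) (le_max_right _ _)) hP
  have hPb : ⌈(2 * C₁) / a⌉₊ ≤ P := le_trans (le_trans (le_max_right _ _) (le_max_right _ _)) hP
  have hPa' : 4 * (A * H₂) / c ≤ P := (Nat.ceil_le).1 hPa
  have hPb' : 2 * C₁ / a ≤ P := (Nat.ceil_le).1 hPb
  -- `A η P ≤ 1/2`
  have hAη1 : A * η P ≤ 1 / 2 := by
    have h1 : A * η P ≤ (A * H₂) * Real.exp (-(c / 2 * P)) := by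
      rw [mul_assoc]; exact mul_le_mul_of_nonneg_left (hηle P) hA0.le
    refine h1.trans (mul_exp_neg_le_half ?_)
    rw [div_le_iff₀ hc] at hPa'
    linarith
  -- the disc chain
  have hεpos : 0 < min (2 * (A * η P)) K := lt_min (by positivity [hη0 P hP1]) hK0
  have hchainP := hchain (h P) K (min (2 * (A * η P)) K) (hhd P)
    (lt_min (mul_pos two_pos (mul_pos hA0 (hη0 P hP1))) hK0) (min_le_right _ _) (hKbound P hP0)
    (fun z hz hzx => le_min (hsmall P hP1 (by linarith) z hz hzx) (hKbound P hP0 z hz))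
  -- `‖h P β‖ ≤ C₁ e^{-aP}`
  have hd : ‖h P β‖ ≤ C₁ * Real.exp (-(a * P)) := by
    refine hchainP.trans ?_
    have h1 : min (2 * (A * η P)) K ≤ (2 * A * H₂) * Real.exp (-(c / 2 * P)) := by
      refine (min_le_left _ _).trans ?_
      have := hηle P
      nlinarith [hA0, this, Real.exp_pos (-(c / 2 * P))]
    have h2 : (min (2 * (A * η P)) K) ^ θ ≤ ((2 * A * H₂) * Real.exp (-(c / 2 * P))) ^ θ :=
      Real.rpow_le_rpow hεpos.le h1 hθ0.le
    have h3 : ((2 * A * H₂) * Real.exp (-(c / 2 * P))) ^ θ = (2 * A * H₂) ^ θ * Real.exp (-(a * P)) := by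
      rw [Real.mul_rpow (by positivity) (Real.exp_pos _).le, ← Real.exp_mul, hadef]
      congr 2; ring
    calc (min (2 * (A * η P)) K) ^ θ * K ^ (1 - θ)
        ≤ ((2 * A * H₂) * Real.exp (-(c / 2 * P))) ^ θ * K ^ (1 - θ) :=
          mul_le_mul_of_nonneg_right h2 (Real.rpow_nonneg hK0.le _)
      _ = C₁ * Real.exp (-(a * P)) := by rw [h3, hC₁]; ring
  -- `‖h P β‖ ≤ 1/2`
  have hd2 : ‖h P β‖ ≤ 1 / 2 := by
    refine hd.trans (mul_exp_neg_le_half ?_)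
    rw [div_le_iff₀ ha0] at hPb'
    linarith
  /- Step 7: conclusion -/
  obtain ⟨hβ0, -⟩ := hW P hP0 β hβ
  have hWdef : h P β = Z P β * exp (E P β) - 1 := rfl
  have hlog : Real.log ‖Z P β * exp (E P β)‖ = Real.log ‖Z P β‖ + (P : ℝ) ^ 4 * (f β).re := by
    rw [hnormZE P β hβ0, Real.log_exp]
  rw [← hlog]
  rw [hWdef] at hd hd2
  exact (abs_log_norm_le_two_mul_norm_sub_one hd2).trans (by linarith)

end Summit.QuantumFields.YangMills.Theorems.ComplexCouplingChannel
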